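import Summits.AtomisticToContinuum.HydrodynamicLimit.Theorems.RelayRaceLocalityNearConstantShortTimeHLSmallTiltGronwallDefs
import Summits.AtomisticToContinuum.HydrodynamicLimit.Theorems.SuperextensiveClosureCostBlockEntropyBudgetBallAverages
import Literature.MathematicalPhysics.KineticTheory.HardSphereEulerProofs
import HarnessLib

/-!
# Crux `NearConstantShortTimeHL` (stmt-AtomisticToContinuum-12502), line `small-tilt-domination` — hard-core packing bound

Support file for the crux `…Theses.RelayRaceLocality.NearConstantShortTimeHL`, line `small-tilt-domination`,
registered stubs `card_filter_near_le` and `ballDensity_le_of_separated` (lead c3, wave 1).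

* `card_filter_near_le` — **packing on `𝕋³`**: among sphere centres at mutual minimal-image distance `≥ ε`,
  at most `((r + ε/2)/(ε/2))³` lie within minimal-image distance `< r` of any given point, provided
  `r + ε/2 < 1/2`. Proof: the torus balls `B(cᵢ, ε/2)` about the near centres are pairwise disjoint
  (triangle inequality for `Torus.euclidDist`) and contained in `B(x₀, r + ε/2)`; all radii are `< 1/2`,
  so their Haar volumes are the Euclidean ones (`volume_setOf_euclidDist_lt_T3`), and additivity /
  monotonicity of `volume` give `card · (4/3)π(ε/2)³ ≤ (4/3)π(r + ε/2)³`.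
* `ballDensity_le_of_separated` — the ball-averaged empirical density of a hard-core configuration,
  `ρ̃_w(x) = ρ_w[ballKernel ℓ x] = n⁻¹ (4/3 π ℓ³)⁻¹ · #{i : d(x, qᵢ) < ℓ}`, is therefore at most
  `n⁻¹ (4/3 π ℓ³)⁻¹ ((ℓ + ε/2)/(ε/2))³` — the `ρ̃ ≤ C/σ³`-type cap used by the mesoscale statics and the
  crude flux bounds of the line.

References: folklore (volume packing); H. Spohn, *Large Scale Dynamics of Interacting Particles* (1991),
Part I §2.1 (hard-core exclusion).
-/

noncomputable section

namespace Summit.AtomisticToContinuum.HydrodynamicLimit.Theorems.NearConstantShortTimeHL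

open scoped BigOperators ENNReal
open MeasureTheory Set Filter
open Literature.MathematicalPhysics.KineticTheory Literature.Analysis.FluidPDE Literature.Analysis.FunctionSpaces

-- adapted from `ContactSourceDuhamel.TimeLocal.PastDamping.card_filter_near_le`
-- (Theorems/CollisionIsometryCLTAdaptedWeightCLTTLPastDampingDensityCap.lean)
/-- **Packing on `𝕋³`.** If the centres `c i` are pairwise at minimal-image distance `≥ ε`, then for
every `x₀ ∈ 𝕋³` at most `((r + ε/2)/(ε/2))³` of them lie at minimal-image distance `< r` from `x₀`
(for `r + ε/2 < 1/2`, so that all the balls involved are Euclidean). [folklore] -/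
theorem card_filter_near_le : ∀ {n : ℕ} {ε r : ℝ}, 0 < ε → 0 < r → r + ε / 2 < 1 / 2 → ∀ (c : Fin n → T3), (∀ i j, i ≠ j → ε ≤ Torus.euclidDist (c i) (c j)) → ∀ x₀ : T3, ((Finset.univ.filter fun i => Torus.euclidDist x₀ (c i) < r).card : ℝ) ≤ ((r + ε / 2) / (ε / 2)) ^ 3 := by
  intro n ε r hε hr hhalf c hsep x₀
  set A := Finset.univ.filter fun i => Torus.euclidDist x₀ (c i) < r with hA
  set U : Fin n → Set T3 := fun i => {y | Torus.euclidDist y (c i) < ε / 2} with hU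
  have hε2 : 0 < ε / 2 := by linarith
  have hε2' : ε / 2 < 1 / 2 := by linarith
  have hrε : 0 < r + ε / 2 := by linarith
  -- the small balls about the near centres are pairwise disjoint
  have hdisj : Set.PairwiseDisjoint (↑A : Set (Fin n)) U := by
    intro i _ j _ hij
    refine Set.disjoint_left.2 fun y hyi hyj => ?_
    have h1 : Torus.euclidDist y (c i) < ε / 2 := hyi
    have h2 : Torus.euclidDist y (c j) < ε / 2 := hyj
    have htri := euclidDist_triangle (c i) y (c j)
    rw [Torus.euclidDist_comm (c i) y] at htri
    have := hsep i j hij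
    linarith
  -- and contained in the big ball about `x₀`
  have hsub : ∀ i ∈ A, U i ⊆ {y | Torus.euclidDist y x₀ < r + ε / 2} := by
    intro i hi y hy
    have hi' : Torus.euclidDist x₀ (c i) < r := (Finset.mem_filter.1 hi).2
    rw [Torus.euclidDist_comm x₀ (c i)] at hi'
    have hy' : Torus.euclidDist y (c i) < ε / 2 := hy
    have htri := euclidDist_triangle y (c i) x₀
    show Torus.euclidDist y x₀ < r + ε / 2
    linarith
  -- compare Haar volumes
  have hvol : ∑ i ∈ A, volume (U i) ≤ volume {y | Torus.euclidDist y x₀ < r + ε / 2} := by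
    rw [← measure_biUnion_finset hdisj fun i _ => measurableSet_setOf_euclidDist_lt (ε / 2) (c i)]
    exact measure_mono (Set.iUnion₂_subset hsub)
  have hUvol : ∀ i ∈ A, volume (U i) = ENNReal.ofReal (4 / 3 * Real.pi * (ε / 2) ^ 3) :=
    fun i _ => volume_setOf_euclidDist_lt_T3 hε2.le hε2' (c i)
  rw [Finset.sum_congr rfl hUvol, Finset.sum_const, nsmul_eq_mul,
    volume_setOf_euclidDist_lt_T3 hrε.le hhalf x₀, ← ENNReal.ofReal_natCast,
    ← ENNReal.ofReal_mul (Nat.cast_nonneg _), ENNReal.ofReal_le_ofReal_iff (by positivity)] at hvol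
  -- cancel the common factor `4/3 π` and divide by `(ε/2)³`
  have hK : 0 < 4 / 3 * Real.pi := by positivity
  have hε3 : 0 < (ε / 2) ^ 3 := by positivity
  have h2 : (A.card : ℝ) * (ε / 2) ^ 3 ≤ (r + ε / 2) ^ 3 := by
    refine le_of_mul_le_mul_left ?_ hK
    calc 4 / 3 * Real.pi * ((A.card : ℝ) * (ε / 2) ^ 3)
        = (A.card : ℝ) * (4 / 3 * Real.pi * (ε / 2) ^ 3) := by ring
      _ ≤ 4 / 3 * Real.pi * (r + ε / 2) ^ 3 := hvol
  rw [div_pow, le_div_iff₀ hε3]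
  exact h2

/-- **Hard-core cap on the ball-averaged empirical density.** For a configuration `w` of `n` spheres
whose centres are pairwise at minimal-image distance `≥ ε`, and a ball radius `ℓ` with
`ℓ + ε/2 < 1/2`, the ball-averaged empirical density satisfies
`ρ_w[ballKernel ℓ x] ≤ n⁻¹ (4/3 π ℓ³)⁻¹ ((ℓ + ε/2)/(ε/2))³` at every `x ∈ 𝕋³`. [folklore] -/
theorem ballDensity_le_of_separated : ∀ {n : ℕ} {ε ℓ : ℝ}, 0 < ε → 0 < ℓ → ℓ + ε / 2 < 1 / 2 → ∀ (w : Config n (Fin 3) T3), (∀ i j, i ≠ j → ε ≤ Torus.euclidDist (w i).1 (w j).1) → ∀ x : T3, empiricalDensityField w (ballKernel ℓ x) ≤ (n : ℝ)⁻¹ * (4 / 3 * Real.pi * ℓ ^ 3)⁻¹ * ((ℓ + ε / 2) / (ε / 2)) ^ 3 := by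
  intro n ε ℓ hε hℓ hhalf w hsep x
  rw [empiricalDensityField_eq_sum]
  have hsum : ∑ i, ballKernel ℓ x (w i).1 =
      (4 / 3 * Real.pi * ℓ ^ 3)⁻¹ *
        ((Finset.univ.filter fun i => Torus.euclidDist x (w i).1 < ℓ).card : ℝ) := by
    simp only [ballKernel]
    rw [Finset.sum_ite, Finset.sum_const_zero, add_zero, Finset.sum_const, nsmul_eq_mul, mul_comm]
  rw [hsum]
  have hcard := card_filter_near_le hε hℓ hhalf (fun i => (w i).1) hsep x
  have hn : 0 ≤ (n : ℝ)⁻¹ := inv_nonneg.2 (Nat.cast_nonneg _)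
  have hK : 0 ≤ (4 / 3 * Real.pi * ℓ ^ 3)⁻¹ := by positivity
  exact (mul_le_mul_of_nonneg_left (mul_le_mul_of_nonneg_left hcard hK) hn).trans_eq
    (mul_assoc _ _ _).symm

end Summit.AtomisticToContinuum.HydrodynamicLimit.Theorems.NearConstantShortTimeHL

end
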